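import Mathlib
import HarnessLib
import Summits.HubbardSuperconductivity.HubbardSuperconductivity.Theorems.KLProgrammeKLRegimeSplitFrameDegreeGuard
import Summits.HubbardSuperconductivity.HubbardSuperconductivity.Theorems.KLProgrammeKLRegimeEngineV8DefsL4
import Summits.HubbardSuperconductivity.HubbardSuperconductivity.Theorems.KLProgrammeKLRegimeSplitSlotsV17F

/-!
# K3 gen-8-FLOW (stmt-HubbardSuperconductivity-20437 `KLRegimeEngineV17F2`, stub (C) `stub_twoLeg_curvature`): the (C) one-call's VOLUME-GUARD family
# `4·klFlowDeg (m+1) ≤ L` from the stub's volume binder `klEngL₄ P R β U ≤ L` (cell gate-hubbard-kl, seat p2 g24)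

The (P)-step / last-step theorems (hence the (C) one-calls `twoLegRead_flow_registered_*_u0f(_hist)`) carry the reading-swap guard `4·klFlowDeg (m+1) ≤ L`
at every scale (`klFlowDeg n = 2⁷·4ⁿ`).  At the engine's volumes it is automatic: `4·klFlowDeg m = 2⁹·4^m ≤ 2⁹·4^{n_β+1} = 2¹¹·4^{n_β} ≤ 2²²·16^{n_β} < L`
whenever `klEngL₃ β U ≤ L` (`two_pow_mul_sixteen_pow_nScales_lt_of_klEngL₃_le`) — in particular under the stub binder `klEngL₄ P R β U ≤ L`
(`klEngL₃_le_of_klEngL₄_le`).  Pure arithmetic; nothing asserts (C), any stub of 20437, K3 or superconductivity.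
References: BGM 2006 §2.4 [cite: BenfattoGiulianiMastropietro2006].
-/

noncomputable section

namespace Summit.HubbardSuperconductivity.HubbardSuperconductivity.Theorems.KLRegimeSplit

set_option linter.dupNamespace false -- summit = problem name (single-conjunct summit), D-0017

open Real Summit.HubbardSuperconductivity.HubbardSuperconductivity.Theorems.EngineV8

/-- `4·klFlowDeg m ≤ 2²²·16^{n_β}` for `m ≤ n_β + 1` (`2⁹·4^m ≤ 2¹¹·4^{n_β} ≤ 2²²·16^{n_β}`). -/
theorem four_mul_klFlowDeg_le_pow {β : ℝ} {m : ℕ} (hm : m ≤ nScales β + 1) : 4 * klFlowDeg m ≤ 2 ^ 22 * 16 ^ nScales β := by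
  unfold klFlowDeg
  have h1 : 4 ^ m ≤ 4 ^ (nScales β + 1) := Nat.pow_le_pow_right (by norm_num) hm
  have h2 : (4 : ℕ) ^ nScales β ≤ 16 ^ nScales β := Nat.pow_le_pow_left (by norm_num) _
  calc 4 * (2 ^ 7 * 4 ^ m) ≤ 4 * (2 ^ 7 * 4 ^ (nScales β + 1)) := by gcongr
    _ = 2 ^ 11 * 4 ^ nScales β := by rw [pow_succ]; ring
    _ ≤ 2 ^ 11 * 16 ^ nScales β := by gcongr
    _ ≤ 2 ^ 22 * 16 ^ nScales β := by gcongr <;> norm_num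

/-- **The volume guard at the engine's volumes**: `klBetaMin ≤ β`, `klEngL₃ β U ≤ L`, `m ≤ nScales β + 1` ⟹ `4·klFlowDeg m ≤ L`. -/
theorem four_mul_klFlowDeg_le_of_klEngL₃_le {β U : ℝ} (hβ : klBetaMin ≤ β) {L : ℕ} (hL : klEngL₃ β U ≤ L) {m : ℕ} (hm : m ≤ nScales β + 1) :
    4 * klFlowDeg m ≤ L :=
  (four_mul_klFlowDeg_le_pow hm).trans (two_pow_mul_sixteen_pow_nScales_lt_of_klEngL₃_le hβ hL).le

/-- **The (C) one-call's `hLdeg` family under the stub's volume binder** `klEngL₄ P R β U ≤ L`: `∀ m, m + 1 ≤ nScales β + 1 → 4·klFlowDeg (m+1) ≤ L`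
(and `hLdegL : 4·klFlowDeg (n_β+1) ≤ L` at `m := n_β`). -/
theorem four_mul_klFlowDeg_succ_le_of_klEngL₄_le {P : SplitConsts} {R : RenConsts} {β U : ℝ} (hβ : klBetaMin ≤ β) {L : ℕ}
    (hL : klEngL₄ P R β U ≤ L) : ∀ m, m + 1 ≤ nScales β + 1 → 4 * klFlowDeg (m + 1) ≤ L :=
  fun _ hm => four_mul_klFlowDeg_le_of_klEngL₃_le hβ (klEngL₃_le_of_klEngL₄_le hL) hm

end Summit.HubbardSuperconductivity.HubbardSuperconductivity.Theorems.KLRegimeSplit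

end
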